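import Literature.NumberTheory.QuadraticFields.ScholzHeckeUnitCriterion
import Literature.NumberTheory.QuadraticFields.SquareRootGenerator
import Literature.NumberTheory.NumberFields.UnramifiedCyclicDegreeDvdClassNumber
import Literature.NumberTheory.NumberFields.KummerCubeRootUnramified
import Literature.NumberTheory.NumberFields.UnramifiedDescentPrimeDegree
import Literature.NumberTheory.NumberFields.KummerSexticAbelian
import Mathlib.RingTheory.Polynomial.RationalRoot
import HarnessLib

/-!
# The Scholz–Hecke unit criterion — proofs (direction (i): the unit is a cube at `3` ⇒ `3 ∣ h(−d)`)

Topic `NumberTheory/QuadraticFields`.  Theorem-only companion of `ScholzHeckeUnitCriterion.lean`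
(the named fact `ScholzHecke_unitCubeCriterion`, Scholz 1932 / Washington Thm 10.10 / Hecke Satz 119),
proving its direction (i) `UnitCubeAtThree d → 3 ∣ h(−d)` (`cube_imp_three_dvd`) along the classical
road (Washington, *Introduction to Cyclotomic Fields*, proof of Thm 10.10, made explicit, with Hecke's
criterion at the prime `3`):

* `K = ℚ(√−d)` (the quadratic field of discriminant `−d`, `Quadratic.exists_numberField_discr_eq`),
  `δ² = −d`; in an algebraic closure: `λ² = −3` (`λ ∉ K` as `d ≠ 3`, `algebraMap_ne_lam`), `M = K(λ)`,
  `√d₀ = δλ/c₀` (`3d = d₀c₀²`, `d₀ = mirrorRadicand d`), and the unit `ε = (a + b√d₀)/2` of the witness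
  `(a, b)` of `UnitCubeAtThree d` (`IsMirrorFundUnit`: `a² − d₀b² = ±4`, `a` least);
* `ε` is not a cube in `M` (`pow_three_ne_unit`): by the norm from `M` down to `ℚ(√d₀)` (written out
  with the conjugation of `K`, `SquareRootGenerator.conj`) a cube root in `M` would give a cube root
  `u + v√d₀`, `u, v ∈ ℚ`, and then (`no_rat_cube_root`, `no_int_cube_root`: rational root theorem +
  the minimality of `a`) a smaller unit — impossible;
* hence (`KummerSexticAbelian`) `N = K(λ, ∛ε)` is Galois over `K` of degree `6` with abelian group and
  has a cubic subfield `E`, cyclic over `K`;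
* `UnitCubeAtThree d` unwinds (`exists_ringOfIntegers_unit_data`, via `Zsqrtd.lift`) to `ε⁸ = 1 + λ³w`
  in `𝓞_M`, so `N = M(∛ε⁸)` is unramified over `M` at every prime (`KummerCubeRootUnramified`, Hecke
  Satz 119 with the tame part), hence `E/K` is unramified everywhere (`UnramifiedDescentPrimeDegree`:
  `e ∣ 3` and `e ≤ [M:K] = 2`);
* an everywhere unramified cyclic cubic extension of the imaginary quadratic `K` forces `3 ∣ h_K`
  (`UnramifiedCyclicDegreeDvdClassNumber`, from the tree's Artin reciprocity), and `h_K = h(−d)`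
  (`Quadratic.card_reducedForms_eq_classNumber`, Cox Thm 7.7).

Main statements: `three_dvd_classNumber_of_unitCubeAtThree` (for the field `K`), `cube_imp_three_dvd`
(the literal direction (i) of the fact).  Direction (ii) (Kummer classification + Hecke's necessity)
is not in this file.

## References

* L. C. Washington, *Introduction to Cyclotomic Fields*, GTM 83 (2nd ed. 1997), Thm 10.10 and its
  proof. [Washington1997]
* E. Hecke, *Lectures on the Theory of Algebraic Numbers*, GTM 77 (1981), §39, Thms 118–119. [Hecke1981]
* A. Scholz, *Über die Beziehung der Klassenzahlen quadratischer Körper zueinander*, J. reine angew.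
  Math. 166 (1932), 201–203. [Scholz1932]
* D. A. Cox, *Primes of the form x² + ny²*, 2nd ed. (2013), Thm 7.7. [Cox2013]
-/

noncomputable section

open Module NumberField Polynomial
open scoped IntermediateField

namespace Literature.NumberTheory.QuadraticFields

namespace ScholzHecke

/-! ### Arithmetic of the mirror radicand `d₀ = mirrorRadicand d` for fundamental `−d` -/

/-- `3d = d₀ c₀²` with `c₀ ∈ {1, 2, 3, 6}`. [folklore] -/
theorem exists_three_mul_eq_mirrorRadicand_mul_sq (d : ℕ) :
    ∃ c₀ : ℕ, 0 < c₀ ∧ 3 * d = mirrorRadicand d * c₀ ^ 2 := by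
  unfold mirrorRadicand
  by_cases h3 : 3 ∣ d <;> by_cases h4 : 4 ∣ d <;> simp only [h3, h4, if_true, if_false]
  · refine ⟨6, by norm_num, ?_⟩
    have h12 : 12 ∣ d := Nat.Coprime.mul_dvd_of_dvd_of_dvd (by norm_num) h3 h4
    obtain ⟨k, rfl⟩ := h12
    rw [Nat.mul_div_cancel_left k (by norm_num)]
    ring
  · refine ⟨3, by norm_num, ?_⟩
    obtain ⟨k, rfl⟩ := h3
    rw [Nat.mul_div_cancel_left k (by norm_num)]
    ring
  · refine ⟨2, by norm_num, ?_⟩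
    obtain ⟨k, rfl⟩ := h4
    rw [Nat.mul_div_cancel_left k (by norm_num)]
    ring
  · exact ⟨1, by norm_num, by ring⟩

/-- `3 ∣ d₀` when `3 ∤ d`. [folklore] -/
theorem three_dvd_mirrorRadicand {d : ℕ} (h3 : ¬ 3 ∣ d) : 3 ∣ mirrorRadicand d := by
  unfold mirrorRadicand
  rw [if_neg h3]
  split_ifs <;> exact dvd_mul_right 3 _

section Fundamental

variable {d : ℕ}
  (hd : ((-(d:ℤ)) % 4 = 1 ∧ Squarefree (-(d:ℤ)) ∧ (-(d:ℤ)) ≠ 1) ∨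
      (4 ∣ (-(d:ℤ)) ∧ ((-(d:ℤ)) / 4 % 4 = 2 ∨ (-(d:ℤ)) / 4 % 4 = 3) ∧ Squarefree ((-(d:ℤ)) / 4)))
include hd

/-- The two shapes of a fundamental `−d`, in terms of `d : ℕ`: `d` squarefree with `4 ∤ d`, or `4 ∣ d`
with `d/4` squarefree and `−d/4 ≡ 2, 3 (mod 4)`. [folklore] -/
theorem squarefree_or_four_dvd :
    (Squarefree d ∧ ¬ 4 ∣ d) ∨ (4 ∣ d ∧ Squarefree (d / 4) ∧
      ((-((d / 4 : ℕ) : ℤ)) % 4 = 2 ∨ (-((d / 4 : ℕ) : ℤ)) % 4 = 3)) := by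
  rcases hd with ⟨_, hsq, _⟩ | ⟨h4, hmod, hsq⟩
  · rw [← Int.squarefree_natAbs, Int.natAbs_neg, Int.natAbs_natCast] at hsq
    refine Or.inl ⟨hsq, fun h4 => ?_⟩
    have := hsq 2 (by simpa using h4)
    norm_num at this
  · have h4' : 4 ∣ d := by
      have := Int.dvd_natAbs.mpr h4
      rw [Int.natAbs_neg, Int.natAbs_natCast] at this
      exact_mod_cast this
    have hdiv : (-(d:ℤ)) / 4 = -((d / 4 : ℕ) : ℤ) := by
      obtain ⟨k, rfl⟩ := h4'
      rw [Nat.mul_div_cancel_left k (by norm_num)]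
      push_cast
      omega
    rw [hdiv] at hmod hsq
    rw [← Int.squarefree_natAbs, Int.natAbs_neg, Int.natAbs_natCast] at hsq
    exact Or.inr ⟨h4', hsq, hmod⟩

/-- `d ≠ 0`. [folklore] -/
theorem pos : 0 < d := by
  rcases squarefree_or_four_dvd hd with ⟨hsq, _⟩ | ⟨_, hsq, hmod⟩
  · exact Nat.pos_of_ne_zero fun h => by rw [h] at hsq; exact not_squarefree_zero hsq
  · exact Nat.pos_of_ne_zero fun h => by
      rw [h] at hsq; exact not_squarefree_zero hsq

/-- **`d₀` is squarefree.** [folklore] -/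
theorem squarefree_mirrorRadicand : Squarefree (mirrorRadicand d) := by
  unfold mirrorRadicand
  rcases squarefree_or_four_dvd hd with ⟨hsq, h4⟩ | ⟨h4, hsq, _⟩
  · rw [if_neg h4, if_neg h4]
    split_ifs with h3
    · exact hsq.squarefree_of_dvd (Nat.div_dvd_of_dvd h3)
    · rw [Nat.squarefree_mul_iff]
      exact ⟨(Nat.Prime.coprime_iff_not_dvd Nat.prime_three).mpr h3, Nat.prime_three.squarefree, hsq⟩
  · rw [if_pos h4, if_pos h4]
    split_ifs with h3
    · have h12 : d / 12 ∣ d / 4 := by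
        refine ⟨3, ?_⟩
        have h12d : 12 ∣ d := Nat.Coprime.mul_dvd_of_dvd_of_dvd (by norm_num) h3 h4
        obtain ⟨k, rfl⟩ := h12d
        rw [Nat.mul_div_cancel_left k (by norm_num), show 12 * k = 4 * (3 * k) by ring,
          Nat.mul_div_cancel_left _ (by norm_num)]
        ring
      exact hsq.squarefree_of_dvd h12
    · rw [Nat.squarefree_mul_iff]
      refine ⟨(Nat.Prime.coprime_iff_not_dvd Nat.prime_three).mpr fun h => h3 ?_,
        Nat.prime_three.squarefree, hsq⟩
      exact h.trans (Nat.div_dvd_of_dvd h4)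

/-- `d₀ ≠ 0`. [folklore] -/
theorem mirrorRadicand_ne_zero : mirrorRadicand d ≠ 0 := fun h => by
  have := squarefree_mirrorRadicand hd
  rw [h] at this
  exact not_squarefree_zero this

omit hd in
/-- **`d₀ ≠ 1`** (for `d ≠ 3`; `d₀ = 1` only for `d ∈ {3, 12}` and `−12` is not fundamental).
[folklore] -/
theorem mirrorRadicand_ne_one
    (hd : ((-(d:ℤ)) % 4 = 1 ∧ Squarefree (-(d:ℤ)) ∧ (-(d:ℤ)) ≠ 1) ∨
      (4 ∣ (-(d:ℤ)) ∧ ((-(d:ℤ)) / 4 % 4 = 2 ∨ (-(d:ℤ)) / 4 % 4 = 3) ∧ Squarefree ((-(d:ℤ)) / 4)))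
    (h3 : d ≠ 3) : mirrorRadicand d ≠ 1 := by
  intro h1
  have hd0 := pos hd
  unfold mirrorRadicand at h1
  rcases squarefree_or_four_dvd hd with ⟨hsq, h4⟩ | ⟨h4, hsq, hmod⟩
  · rw [if_neg h4, if_neg h4] at h1
    split_ifs at h1 with h3d
    · obtain ⟨k, rfl⟩ := h3d
      rw [Nat.mul_div_cancel_left k (by norm_num)] at h1
      subst h1
      exact h3 rfl
    · omega
  · rw [if_pos h4, if_pos h4] at h1
    split_ifs at h1 with h3d
    · have h12d : 12 ∣ d := Nat.Coprime.mul_dvd_of_dvd_of_dvd (by norm_num) h3d h4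
      obtain ⟨k, rfl⟩ := h12d
      rw [Nat.mul_div_cancel_left k (by norm_num)] at h1
      subst h1
      norm_num at hmod
    · omega

/-- `3d` is not a rational square unless `d = 3` (`−3` being the only fundamental discriminant in the
square class of `−d`). [folklore] -/
theorem not_exists_rat_sq (h3 : d ≠ 3) : ¬ ∃ t : ℚ, (d : ℚ) * t ^ 2 = 3 := by
  rintro ⟨t, ht⟩
  have ht0 : t ≠ 0 := by rintro rfl; norm_num at ht
  have hfund3 : ((-3 : ℤ) % 4 = 1 ∧ Squarefree (-3 : ℤ) ∧ (-3 : ℤ) ≠ 1) ∨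
      (4 ∣ (-3 : ℤ) ∧ ((-3 : ℤ) / 4 % 4 = 2 ∨ (-3 : ℤ) / 4 % 4 = 3) ∧ Squarefree ((-3 : ℤ) / 4)) := by
    refine Or.inl ⟨by norm_num, ?_, by norm_num⟩
    rw [← Int.squarefree_natAbs]
    exact Nat.prime_three.squarefree
  have := Quadratic.eq_of_isFundamental_of_eq_mul_sq hd hfund3 (q := t⁻¹) (by
    push_cast
    field_simp
    linear_combination -ht)
  omega

end Fundamental

/-! ### The fundamental unit is not a cube in `ℚ(√d₀)` (elementary) -/

/-- A rational root of a monic integer cubic `X³ + c₁X + c₀` is an integer. [folklore] -/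
theorem exists_int_of_cubic {x : ℚ} {c₁ c₀ : ℤ} (hx : x ^ 3 + c₁ * x + c₀ = 0) : ∃ z : ℤ, (z : ℚ) = x := by
  have hmonic : (X ^ 3 + C c₁ * X + C c₀ : ℤ[X]).Monic := by monicity!
  obtain ⟨z, hz⟩ := isInteger_of_is_root_of_monic hmonic (r := x) (by simpa using hx)
  exact ⟨z, by simpa using hz⟩

/-- A rational square root of an integer is an integer. [folklore] -/
theorem exists_int_of_sq {x : ℚ} {c : ℤ} (hx : x ^ 2 = c) : ∃ z : ℤ, (z : ℚ) = x := by
  have hmonic : (X ^ 2 - C c : ℤ[X]).Monic := monic_X_pow_sub_C c two_ne_zero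
  obtain ⟨z, hz⟩ := isInteger_of_is_root_of_monic hmonic (r := x) (by simp [hx])
  exact ⟨z, by simpa using hz⟩

/-- A rational cube root of `±1` is `±1`. [folklore] -/
theorem eq_of_pow_three_eq {N : ℚ} {n : ℤ} (hn : n = 1 ∨ n = -1) (h : N ^ 3 = n) : N = n := by
  have key : (N - n) * (N ^ 2 + n * N + 1) = 0 := by
    rcases hn with rfl | rfl <;> push_cast at h ⊢ <;> linear_combination h
  rcases mul_eq_zero.mp key with h0 | h0
  · linear_combination h0
  · exfalso
    rcases hn with rfl | rfl <;> push_cast at h0 <;>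
      nlinarith [sq_nonneg (2 * N + 1), sq_nonneg (2 * N - 1)]

/-- **Integer core of the non-cube lemma.**  Let `d₀ ≠ 1` be squarefree, `a² − d₀b² = 4n`, `n = ±1`,
`b > 0`, with `a` least among all such solutions.  Then there are no integers `A, B` with
`a = A³ − 3nA`, `b = B(A² − n)`, `A² − d₀B² = 4n` (i.e. `(a + b√d₀)/2` is not the cube of the unit
`(A + B√d₀)/2`): minimality gives `a ≤ |A|`, whence `|A² − 3n| ≤ 1`, `n = 1`, `A² = 4`, `B = 0`,
`b = 0`. [folklore] -/
theorem no_int_cube_root {d₀ a b : ℕ} {n : ℤ} (hsq : Squarefree d₀) (h1 : d₀ ≠ 1) (hb : 0 < b)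
    (hn : n = 1 ∨ n = -1)
    (hmin : ∀ a' b' : ℕ, 0 < b' →
      ((a':ℤ) ^ 2 - (d₀ : ℤ) * (b':ℤ) ^ 2 = 4 ∨ (a':ℤ) ^ 2 - (d₀ : ℤ) * (b':ℤ) ^ 2 = -4) → a ≤ a')
    {A B : ℤ} (hA : (a : ℤ) = A ^ 3 - 3 * n * A) (hB : (b : ℤ) = B * (A ^ 2 - n))
    (hAB : A ^ 2 - (d₀ : ℤ) * B ^ 2 = 4 * n) : False := by
  have hB0 : B ≠ 0 := by
    rintro rfl
    rw [zero_mul] at hB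
    omega
  -- minimality: `a ≤ |A|`
  have hle : (a : ℤ) ≤ |A| := by
    have := hmin A.natAbs B.natAbs (Int.natAbs_pos.mpr hB0) (by
      push_cast
      rw [sq_abs, sq_abs]
      rcases hn with rfl | rfl
      · left; linear_combination hAB
      · right; linear_combination hAB)
    rw [Int.abs_eq_natAbs]
    exact_mod_cast this
  -- `a = |A| · |A² − 3n| > 0`
  have ha0 : (a : ℤ) ≠ 0 := by
    intro ha
    rw [ha] at hA
    -- then `A (A² − 3n) = 0`; `A = 0` gives `d₀ B² = −4n`, so `n = −1`, `d₀ B² = 4`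
    have hA0 : A * (A ^ 2 - 3 * n) = 0 := by linear_combination -hA
    rcases mul_eq_zero.mp hA0 with hA0 | hA0
    · subst hA0
      have h4 : (d₀ : ℤ) * B ^ 2 = -(4 * n) := by linear_combination -hAB
      rcases hn with rfl | rfl
      · nlinarith [sq_nonneg B, mul_nonneg (Nat.cast_nonneg (α := ℤ) d₀) (sq_nonneg B)]
      · -- `d₀ B² = 4`: `|B| = 1 ⇒ d₀ = 4` (not squarefree), `|B| = 2 ⇒ d₀ = 1`, `|B| ≥ 3` impossible
        have hB2 : B ^ 2 = 1 ∨ B ^ 2 = 4 ∨ 9 ≤ B ^ 2 := by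
          rcases le_or_gt 3 |B| with h | h
          · right; right; nlinarith [abs_mul_abs_self B, abs_nonneg B]
          · have : |B| = 1 ∨ |B| = 2 := by
              have := abs_pos.mpr hB0
              omega
            rcases this with h | h
            · left; nlinarith [abs_mul_abs_self B]
            · right; left; nlinarith [abs_mul_abs_self B]
        have hd0 : (0 : ℤ) ≤ d₀ := Nat.cast_nonneg _
        rcases hB2 with h | h | h
        · rw [h] at h4
          have : d₀ = 4 := by exact_mod_cast (show (d₀ : ℤ) = 4 by linear_combination h4)
          subst this
          exact absurd (hsq 2 ⟨1, rfl⟩) (by norm_num)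
        · rw [h] at h4
          have : d₀ = 1 := by omega
          exact h1 this
        · rcases Nat.eq_zero_or_pos d₀ with h0 | hpos
          · subst h0; simp at h4
          · have : (1:ℤ) ≤ d₀ := by exact_mod_cast hpos
            nlinarith
    · -- `A² = 3n`: impossible mod 3 / sign
      rcases hn with rfl | rfl
      · have : A ^ 2 = 3 := by linear_combination hA0
        have hA3 : |A| ≤ 1 ∨ 2 ≤ |A| := by omega
        rcases hA3 with h | h <;> nlinarith [abs_mul_abs_self A, abs_nonneg A]
      · nlinarith [sq_nonneg A]
  have hapos : (0 : ℤ) < a := by positivity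
  -- `|A² − 3n| ≤ 1`
  have hA0 : A ≠ 0 := by
    rintro rfl
    exact ha0 (by rw [hA]; ring)
  have habs : |A ^ 2 - 3 * n| ≤ 1 := by
    have h1 : (a : ℤ) = |A| * |A ^ 2 - 3 * n| := by
      rw [← abs_mul, show A * (A ^ 2 - 3 * n) = (a : ℤ) by linear_combination -hA, Nat.abs_cast]
    have hApos : 0 < |A| := abs_pos.mpr hA0
    by_contra hlt
    rw [not_le] at hlt
    have : |A| * 2 ≤ |A| * |A ^ 2 - 3 * n| := by
      apply mul_le_mul_of_nonneg_left _ (abs_nonneg A)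
      omega
    linarith
  -- conclude
  rcases hn with rfl | rfl
  · -- `|A² − 3| ≤ 1 ⇒ A² = 4 ⇒ d₀ B² = 0`
    have hA2 : A ^ 2 = 4 := by
      have h' := abs_le.mp habs
      have : A ^ 2 = 2 ∨ A ^ 2 = 3 ∨ A ^ 2 = 4 := by omega
      rcases this with h | h | h
      · exfalso
        have : |A| ≤ 1 ∨ 2 ≤ |A| := by omega
        rcases this with h' | h' <;> nlinarith [abs_mul_abs_self A, abs_nonneg A]
      · exfalso
        have : |A| ≤ 1 ∨ 2 ≤ |A| := by omega
        rcases this with h' | h' <;> nlinarith [abs_mul_abs_self A, abs_nonneg A]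
      · exact h
    have : (d₀ : ℤ) * B ^ 2 = 0 := by linear_combination hA2 - hAB
    rcases mul_eq_zero.mp this with h | h
    · have h0 : d₀ = 0 := by exact_mod_cast h
      rw [h0] at hsq
      exact not_squarefree_zero hsq
    · exact hB0 (pow_eq_zero_iff two_ne_zero |>.mp h)
  · have h' := abs_le.mp habs
    nlinarith [sq_nonneg A]

/-- **`ε = (a + b√d₀)/2` is not a cube in `k = ℚ(√d₀)`**, in coordinates: there are no rationals
`u, v` with `(u + v√d₀)³ = (a + b√d₀)/2`, i.e. with `u³ + 3d₀uv² = a/2` and `3u²v + d₀v³ = b/2`.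
(Taking norms, `(u² − d₀v²)³ = n`, so `u² − d₀v² = n`; then `A = 2u`, `B = 2v` satisfy
`a = A³ − 3nA`, `b = B(A² − n)`, `A² − d₀B² = 4n`, and `A, B ∈ ℤ` by the rational root theorem and
`d₀` squarefree; now `no_int_cube_root`.)  [folklore] -/
theorem no_rat_cube_root {d₀ a b : ℕ} {n : ℤ} (hsq : Squarefree d₀) (h1 : d₀ ≠ 1) (hb : 0 < b)
    (hn : n = 1 ∨ n = -1) (hab : (a:ℤ) ^ 2 - (d₀ : ℤ) * (b:ℤ) ^ 2 = 4 * n)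
    (hmin : ∀ a' b' : ℕ, 0 < b' →
      ((a':ℤ) ^ 2 - (d₀ : ℤ) * (b':ℤ) ^ 2 = 4 ∨ (a':ℤ) ^ 2 - (d₀ : ℤ) * (b':ℤ) ^ 2 = -4) → a ≤ a')
    {u v : ℚ} (hu : u ^ 3 + 3 * d₀ * u * v ^ 2 = a / 2) (hv : 3 * u ^ 2 * v + d₀ * v ^ 3 = b / 2) :
    False := by
  have habQ : (a:ℚ) ^ 2 - (d₀ : ℚ) * (b:ℚ) ^ 2 = 4 * n := by exact_mod_cast hab
  -- the norm: `(u² − d₀v²)³ = n`, hence `u² − d₀v² = n`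
  have hN3 : (u ^ 2 - d₀ * v ^ 2) ^ 3 = n := by
    linear_combination (u ^ 3 + 3 * d₀ * u * v ^ 2 + a / 2) * hu
      - d₀ * (3 * u ^ 2 * v + d₀ * v ^ 3 + b / 2) * hv + (1/4 : ℚ) * habQ
  have hN : u ^ 2 - d₀ * v ^ 2 = n := eq_of_pow_three_eq hn hN3
  -- `A = 2u`, `B = 2v`
  have hA : (a : ℚ) = (2 * u) ^ 3 - 3 * n * (2 * u) := by linear_combination -2 * hu - 6 * u * hN
  have hB : (b : ℚ) = (2 * v) * ((2 * u) ^ 2 - n) := by linear_combination -2 * hv - 2 * v * hN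
  have hAB : (2 * u) ^ 2 - d₀ * (2 * v) ^ 2 = 4 * n := by linear_combination 4 * hN
  -- `A ∈ ℤ`
  obtain ⟨A, hAu⟩ := exists_int_of_cubic (x := 2 * u) (c₁ := -3 * n) (c₀ := -a) (by
    push_cast; linear_combination -hA)
  -- `B ∈ ℤ`: `(d₀ B)² = d₀ (A² − 4n)` is an integer square, and `d₀ ∣ d₀B` as `d₀` is squarefree
  obtain ⟨C, hC⟩ := exists_int_of_sq (x := d₀ * (2 * v)) (c := d₀ * (A ^ 2 - 4 * n)) (by
    push_cast; rw [hAu]; linear_combination -(d₀ : ℚ) * hAB)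
  have hC2 : C ^ 2 = d₀ * (A ^ 2 - 4 * n) := by
    have : (C : ℚ) ^ 2 = d₀ * (A ^ 2 - 4 * n) := by
      rw [hC, hAu]; linear_combination -(d₀ : ℚ) * hAB
    exact_mod_cast this
  have hdvd : (d₀ : ℤ) ∣ C := by
    have hsqZ : Squarefree (d₀ : ℤ) := Int.squarefree_natCast.mpr hsq
    exact (hsqZ.dvd_pow_iff_dvd two_ne_zero).mp ⟨_, hC2⟩
  obtain ⟨B, hBC⟩ := hdvd
  have hd0 : (d₀ : ℚ) ≠ 0 := by
    have : d₀ ≠ 0 := fun h => by rw [h] at hsq; exact not_squarefree_zero hsq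
    exact_mod_cast this
  have hBv : (B : ℚ) = 2 * v := by
    have : (C : ℚ) = d₀ * B := by exact_mod_cast hBC
    rw [this] at hC
    exact mul_left_cancel₀ hd0 hC
  -- transfer the three identities to `ℤ` and conclude
  refine no_int_cube_root hsq h1 hb hn hmin (A := A) (B := B) ?_ ?_ ?_
  · have : ((a : ℤ) : ℚ) = ((A ^ 3 - 3 * n * A : ℤ) : ℚ) := by push_cast; rw [hAu]; exact hA
    exact_mod_cast this
  · have : ((b : ℤ) : ℚ) = ((B * (A ^ 2 - n) : ℤ) : ℚ) := by push_cast; rw [hAu, hBv]; exact hB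
    exact_mod_cast this
  · have : ((A ^ 2 - (d₀ : ℤ) * B ^ 2 : ℤ) : ℚ) = ((4 * n : ℤ) : ℚ) := by
      push_cast; rw [hAu, hBv]; exact hAB
    exact_mod_cast this

/-! ### `ε` is not a cube in `M = K(λ)` (`K = ℚ(√−d)`, `λ² = −3`): the norm trick down to `k = ℚ(√d₀)` -/

section FieldLevel

variable {K L : Type*} [Field K] [Field L] [Algebra K L]

/-- `(X + Yλ)³ = (X³ − 9XY²) + (3X²Y − 3Y³)λ` when `λ² = −3`. [folklore] -/
theorem cube_add_mul_lam {lam X Y : L} (hlam : lam ^ 2 = -3) :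
    (X + Y * lam) ^ 3 = (X ^ 3 - 9 * X * Y ^ 2) + (3 * X ^ 2 * Y - 3 * Y ^ 3) * lam := by
  linear_combination (3 * X * Y ^ 2 + Y ^ 3 * lam) * hlam

/-- `K`-coordinates of the elements of `K(λ)` (`λ ∉ K`, `λ² = −3`). [folklore] -/
theorem exists_coords_of_mem_adjoin [CharZero K] [CharZero L] {lam : L} (hlam : lam ^ 2 = -3)
    (hlamK : ∀ x : K, algebraMap K L x ≠ lam) {c : L} (hc : c ∈ K⟮lam⟯) :
    ∃ x₀ x₁ : K, c = algebraMap K L x₀ + algebraMap K L x₁ * lam := by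
  have h2 := NumberFields.KummerSextic.finrank_adjoin_lam hlam hlamK
  have hθ : (IntermediateField.AdjoinSimple.gen K lam : K⟮lam⟯) ∉
      Set.range (algebraMap K K⟮lam⟯) := by
    rintro ⟨x, hx⟩
    apply hlamK x
    have := congrArg ((↑) : K⟮lam⟯ → L) hx
    rwa [IntermediateField.coe_algebraMap_apply, IntermediateField.AdjoinSimple.coe_gen] at this
  obtain ⟨x₀, x₁, h⟩ := Quadratic.exists_eq_add_mul h2 hθ ⟨c, hc⟩
  refine ⟨x₀, x₁, ?_⟩
  have := congrArg ((↑) : K⟮lam⟯ → L) h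
  rwa [IntermediateField.coe_add, IntermediateField.coe_mul, IntermediateField.coe_algebraMap_apply,
    IntermediateField.coe_algebraMap_apply, IntermediateField.AdjoinSimple.coe_gen] at this

/-- **The unit `ε = a/2 + (b/2c₀)·δλ` (`= (a + b√d₀)/2`, `√d₀ = δλ/c₀`) is not a cube in `M = K(λ)`.**
If `c = x₀ + x₁λ ∈ M` had `c³ = ε`, then with `σ` the conjugation of `K = ℚ(δ)` the element
`c' = σx₀ − σx₁·λ` (the image of `c` under the automorphism of `M` fixing `√d₀`) also has `c'³ = ε`,
`g = cc'` has `g³ = ε²` and `√d₀`-rational coordinates, and `h = ε/g = u + v·δλ` (`u, v ∈ ℚ`) has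
`h³ = ε` — contradicting `no_rat_cube_root`. [folklore] -/
theorem pow_three_ne_unit [CharZero K] [CharZero L] (h2 : finrank ℚ K = 2) {δ : K}
    (hδ : δ ∉ Set.range (algebraMap ℚ K)) {d : ℕ} (hδ2 : δ ^ 2 = -(d : K))
    {lam : L} (hlam : lam ^ 2 = -3) (hlamK : ∀ x : K, algebraMap K L x ≠ lam)
    {d₀ a b c₀ : ℕ} {n : ℤ} (hsq : Squarefree d₀) (h1 : d₀ ≠ 1) (hb : 0 < b) (hn : n = 1 ∨ n = -1)
    (hab : (a:ℤ) ^ 2 - (d₀ : ℤ) * (b:ℤ) ^ 2 = 4 * n)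
    (hmin : ∀ a' b' : ℕ, 0 < b' →
      ((a':ℤ) ^ 2 - (d₀ : ℤ) * (b':ℤ) ^ 2 = 4 ∨ (a':ℤ) ^ 2 - (d₀ : ℤ) * (b':ℤ) ^ 2 = -4) → a ≤ a')
    (hc₀ : 3 * d = d₀ * c₀ ^ 2) (hc₀0 : c₀ ≠ 0) {c : L} (hc : c ∈ K⟮lam⟯) :
    c ^ 3 ≠ algebraMap K L ((a : K) / 2) + algebraMap K L ((b : K) / (2 * c₀) * δ) * lam := by
  intro h
  have hlamK' : lam ∉ Set.range (algebraMap K L) := fun ⟨x, hx⟩ => hlamK x hx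
  have hδ0 : δ ≠ 0 := Quadratic.ne_zero_of_not_mem_range hδ
  have hc₀K : (c₀ : K) ≠ 0 := Nat.cast_ne_zero.mpr hc₀0
  -- the conjugation `σ` of `K = ℚ(δ)`
  have hδc : δ ^ 2 = algebraMap ℚ K (-(d : ℚ)) := by rw [hδ2, map_neg, map_natCast]
  set σ := Quadratic.conj h2 hδ hδc with hσ_def
  have hσδ : σ δ = -δ := Quadratic.conj_gen h2 hδ hδc
  set p : K := (a : K) / 2 with hp
  set q : K := (b : K) / (2 * c₀) * δ with hq
  have hσp : σ p = p := by rw [hp, map_div₀, map_natCast, map_ofNat]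
  have hσq : σ q = -q := by
    rw [hq, map_mul, map_div₀, map_natCast, map_mul, map_ofNat, map_natCast, hσδ, mul_neg]
  -- (a) coordinates of `c`, (b) the coordinate equations of `c³ = ε`
  obtain ⟨x₀, x₁, rfl⟩ := exists_coords_of_mem_adjoin hlam hlamK hc
  have e1 : algebraMap K L (x₀ ^ 3 - 9 * x₀ * x₁ ^ 2) +
      algebraMap K L (3 * x₀ ^ 2 * x₁ - 3 * x₁ ^ 3) * lam =
      algebraMap K L p + algebraMap K L q * lam := by
    rw [← h, cube_add_mul_lam hlam]
    simp only [map_sub, map_mul, map_pow, map_ofNat]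
  obtain ⟨E1, E2⟩ := Quadratic.ext_add_mul hlamK' e1
  -- (c) conjugate equations, (d) `c' = σx₀ − σx₁ λ` has `c'³ = ε`
  have E1' : σ x₀ ^ 3 - 9 * σ x₀ * σ x₁ ^ 2 = p := by
    simpa only [map_sub, map_mul, map_pow, map_ofNat, hσp] using congrArg σ E1
  have E2' : 3 * σ x₀ ^ 2 * σ x₁ - 3 * σ x₁ ^ 3 = -q := by
    simpa only [map_sub, map_mul, map_pow, map_ofNat, hσq] using congrArg σ E2
  have F1 : algebraMap K L (σ x₀) ^ 3 - 9 * algebraMap K L (σ x₀) * algebraMap K L (σ x₁) ^ 2 =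
      algebraMap K L p := by
    simpa only [map_sub, map_mul, map_pow, map_ofNat] using congrArg (algebraMap K L) E1'
  have F2 : 3 * algebraMap K L (σ x₀) ^ 2 * algebraMap K L (σ x₁) - 3 * algebraMap K L (σ x₁) ^ 3 =
      -algebraMap K L q := by
    simpa only [map_sub, map_mul, map_pow, map_ofNat, map_neg] using congrArg (algebraMap K L) E2'
  have e2 : (algebraMap K L (σ x₀) - algebraMap K L (σ x₁) * lam) ^ 3 =
      algebraMap K L p + algebraMap K L q * lam := by
    linear_combination F1 - lam * F2 +
      (3 * algebraMap K L (σ x₀) * algebraMap K L (σ x₁) ^ 2 - algebraMap K L (σ x₁) ^ 3 * lam) * hlam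
  -- (e) `g = c c'` and its coordinates `g₀, g₁`; `σ g₀ = g₀`, `σ g₁ = −g₁`
  set g₀ : K := x₀ * σ x₀ + 3 * x₁ * σ x₁ with hg₀
  set g₁ : K := x₁ * σ x₀ - x₀ * σ x₁ with hg₁
  have hσσ : ∀ x, σ (σ x) = x := Quadratic.conj_conj h2 hδ hδc
  have hσg₀ : σ g₀ = g₀ := by
    rw [hg₀]; simp only [map_add, map_mul, map_ofNat, hσσ]; ring
  have hσg₁ : σ g₁ = -g₁ := by
    rw [hg₁]; simp only [map_sub, map_mul, hσσ]; ring
  have hg : (algebraMap K L x₀ + algebraMap K L x₁ * lam) *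
      (algebraMap K L (σ x₀) - algebraMap K L (σ x₁) * lam) =
      algebraMap K L g₀ + algebraMap K L g₁ * lam := by
    rw [hg₀, hg₁]
    simp only [map_add, map_sub, map_mul, map_ofNat]
    linear_combination (-(algebraMap K L x₁ * algebraMap K L (σ x₁))) * hlam
  -- the norm `N = g ḡ = g₀² + 3g₁²` and `h = ε ḡ / N`
  set N : K := g₀ ^ 2 + 3 * g₁ ^ 2 with hN
  have hσN : σ N = N := by rw [hN]; simp only [map_add, map_mul, map_pow, map_ofNat, hσg₀, hσg₁]; ring
  have hggbar : (algebraMap K L g₀ + algebraMap K L g₁ * lam) *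
      (algebraMap K L g₀ - algebraMap K L g₁ * lam) = algebraMap K L N := by
    rw [hN]
    simp only [map_add, map_mul, map_pow, map_ofNat]
    linear_combination (-(algebraMap K L g₁) ^ 2) * hlam
  -- nonvanishing
  have hε0 : algebraMap K L p + algebraMap K L q * lam ≠ 0 := by
    intro h0
    have h0' : algebraMap K L p + algebraMap K L q * lam = algebraMap K L 0 + algebraMap K L 0 * lam := by
      rw [h0, map_zero, zero_mul, zero_add]
    obtain ⟨hp0, -⟩ := Quadratic.ext_add_mul hlamK' h0'
    rw [hp] at hp0
    have ha0 : (a : K) = 0 := by linear_combination 2 * hp0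
    have ha0' : a = 0 := by exact_mod_cast ha0
    subst ha0'
    -- `−d₀ b² = 4n` with `d₀` squarefree `≠ 1`, `b > 0`: impossible (as in `no_int_cube_root`)
    exact no_int_cube_root hsq h1 hb hn hmin (A := 0) (B := b) (by ring) (by
      rcases hn with rfl | rfl
      · exfalso
        push_cast at hab
        nlinarith [hab, mul_nonneg (Nat.cast_nonneg (α := ℤ) d₀) (sq_nonneg (b:ℤ))]
      · ring) (by linear_combination hab)
  have hg0 : algebraMap K L g₀ + algebraMap K L g₁ * lam ≠ 0 := by
    rw [← hg]
    refine mul_ne_zero (fun h0 => hε0 ?_) (fun h0 => hε0 ?_)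
    · rw [← h, h0]; ring
    · rw [← e2, h0]; ring
  have hgbar0 : algebraMap K L g₀ - algebraMap K L g₁ * lam ≠ 0 := by
    intro h0
    have h0' : algebraMap K L g₀ + algebraMap K L (-g₁) * lam =
        algebraMap K L 0 + algebraMap K L 0 * lam := by
      rw [map_neg, map_zero, zero_mul, zero_add, neg_mul, ← sub_eq_add_neg, h0]
    obtain ⟨h00, h01⟩ := Quadratic.ext_add_mul hlamK' h0'
    apply hg0
    rw [h00, neg_eq_zero.mp h01, map_zero, zero_mul, zero_add]
  have hN0 : algebraMap K L N ≠ 0 := by rw [← hggbar]; exact mul_ne_zero hg0 hgbar0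
  have hN0K : N ≠ 0 := fun h0 => hN0 (by rw [h0, map_zero])
  -- `h = ε ḡ / N` has `h³ = ε`
  have hG3 : (algebraMap K L g₀ + algebraMap K L g₁ * lam) ^ 3 =
      (algebraMap K L p + algebraMap K L q * lam) ^ 2 := by
    rw [← hg, mul_pow, h, e2, sq]
  set h₀ : K := (p * g₀ + 3 * q * g₁) / N with hh₀
  set h₁ : K := (q * g₀ - p * g₁) / N with hh₁
  have hH : algebraMap K L h₀ + algebraMap K L h₁ * lam =
      (algebraMap K L p + algebraMap K L q * lam) *
        (algebraMap K L g₀ - algebraMap K L g₁ * lam) / algebraMap K L N := by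
    rw [hh₀, hh₁]
    simp only [map_div₀, map_add, map_sub, map_mul, map_ofNat]
    field_simp
    linear_combination (algebraMap K L q * algebraMap K L g₁) * hlam
  have hH3 : (algebraMap K L h₀ + algebraMap K L h₁ * lam) ^ 3 =
      algebraMap K L p + algebraMap K L q * lam := by
    rw [hH, div_pow, mul_pow, div_eq_iff (pow_ne_zero 3 hN0), ← hggbar, mul_pow, hG3]
    ring
  -- `h₀ ∈ ℚ`, `h₁ ∈ ℚ δ`
  have hσh₀ : σ h₀ = h₀ := by
    rw [hh₀]
    simp only [map_div₀, map_add, map_mul, map_ofNat, hσp, hσq, hσg₀, hσg₁, hσN]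
    ring
  have hσh₁ : σ h₁ = -h₁ := by
    rw [hh₁]
    simp only [map_div₀, map_sub, map_mul, hσp, hσq, hσg₀, hσg₁, hσN]
    ring
  obtain ⟨u, hu⟩ := Quadratic.exists_eq_algebraMap_of_conj_eq h2 hδ hδc hσh₀
  obtain ⟨v, hv⟩ := Quadratic.exists_eq_mul_of_conj_eq_neg h2 hδ hδc hσh₁
  rw [eq_ratCast] at hu hv
  -- (g) expand `h³ = ε` in coordinates: `u³ + 9duv² = a/2`, `3u²v + 3dv³ = b/(2c₀)`
  have e3 : algebraMap K L (((u : K) ^ 3 + 9 * d * u * v ^ 2 : K)) +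
      algebraMap K L (((3 * u ^ 2 * v + 3 * d * v ^ 3 : K) * δ)) * lam =
      algebraMap K L p + algebraMap K L q * lam := by
    rw [← hH3, hu, hv, cube_add_mul_lam hlam]
    have hδL : (algebraMap K L δ) ^ 2 = -(d : L) := by
      rw [← map_pow, hδ2, map_neg, map_natCast]
    simp only [map_add, map_mul, map_pow, map_ratCast, map_natCast, map_ofNat]
    linear_combination (9 * (u : L) * (v : L) ^ 2 + 3 * (v : L) ^ 3 * algebraMap K L δ * lam) * hδL
  obtain ⟨E3, E4⟩ := Quadratic.ext_add_mul hlamK' e3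
  rw [hp] at E3
  rw [hq] at E4
  have E4' : (3 * u ^ 2 * v + 3 * d * v ^ 3 : K) = (b : K) / (2 * c₀) := mul_right_cancel₀ hδ0 E4
  have hu' : (u : ℚ) ^ 3 + 9 * d * u * v ^ 2 = a / 2 := by
    refine Rat.cast_injective (α := K) ?_
    push_cast
    exact E3
  have hv' : 3 * (u : ℚ) ^ 2 * v + 3 * d * v ^ 3 = b / (2 * c₀) := by
    refine Rat.cast_injective (α := K) ?_
    push_cast
    exact E4'
  -- (h) the rational equations of `no_rat_cube_root` for `(u, c₀ v)`
  have hc₀Q : (c₀ : ℚ) ≠ 0 := Nat.cast_ne_zero.mpr hc₀0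
  have h3d : (3 * d : ℚ) = d₀ * c₀ ^ 2 := by exact_mod_cast hc₀
  refine no_rat_cube_root hsq h1 hb hn hab hmin (u := u) (v := c₀ * v) ?_ ?_
  · linear_combination hu' - 3 * u * v ^ 2 * h3d
  · rw [eq_div_iff (by positivity)] at hv'
    linear_combination hv' / 2 - c₀ * v ^ 3 * h3d

end FieldLevel

/-! ### `UnitCubeAtThree` ⇒ `ε⁸ ≡ 1 (mod λ³)` in `𝓞_M` (the arithmetic spelling, unwound) -/

section UnitData

/-- Case `3 ∣ d` (`9 ∣ Y`): from `256 ε⁸ = X + Y s`, `X = 9X₁ + 4`, `Y = 9Y₁` and `λ⁴ = 9`: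
`ε⁸ = 1 + λ³ · λ(57(ε⁸ − 1) − 2(X₁ + Y₁ s − 28))` (note `513 = 9·57 = 2·256 + 1`). [folklore] -/
theorem pow_eight_eq_of_nine_dvd {R : Type*} [CommRing R] {lam s ε : R} {X Y X₁ Y₁ : ℤ}
    (hlam : lam ^ 2 = -3) (h256 : 256 * ε ^ 8 = X + Y * s) (hX : X = 9 * X₁ + 4) (hY : Y = 9 * Y₁) :
    ε ^ 8 = 1 + lam ^ 3 * (lam * (57 * (ε ^ 8 - 1) - 2 * ((X₁ : R) + Y₁ * s - 28))) := by
  have hl4 : lam ^ 4 = 9 := by linear_combination (lam ^ 2 - 3) * hlam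
  rw [hX, hY] at h256
  push_cast at h256
  linear_combination (-2 : R) * h256 - (57 * (ε ^ 8 - 1) - 2 * ((X₁ : R) + Y₁ * s - 28)) * hl4

/-- Case `3 ∤ d` (`3 ∣ Y`, `3 ∣ d₀`, `s = λμ`): from `256 ε⁸ = X + Y λμ`, `X = 9X₁ + 4`, `Y = 3Y₁`:
`ε⁸ = 1 + λ³ (57λ(ε⁸ − 1) − 2λ(X₁ − 28) + 2Y₁μ)` (using `λ⁴ = 9`, `3λμ = −λ³μ`). [folklore] -/
theorem pow_eight_eq_of_three_dvd {R : Type*} [CommRing R] {lam μ ε : R} {X Y X₁ Y₁ : ℤ}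
    (hlam : lam ^ 2 = -3) (h256 : 256 * ε ^ 8 = X + Y * (lam * μ)) (hX : X = 9 * X₁ + 4)
    (hY : Y = 3 * Y₁) :
    ε ^ 8 = 1 + lam ^ 3 * (57 * lam * (ε ^ 8 - 1) - 2 * lam * ((X₁ : R) - 28) + 2 * Y₁ * μ) := by
  have hl4 : lam ^ 4 = 9 := by linear_combination (lam ^ 2 - 3) * hlam
  rw [hX, hY] at h256
  push_cast at h256
  linear_combination (-2 : R) * h256 - (57 * (ε ^ 8 - 1) - 2 * ((X₁ : R) - 28)) * hl4 -
    2 * lam * Y₁ * μ * hlam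

/-- A root of a monic integer quadratic `X² − aX + n` is integral. [folklore] -/
theorem isIntegral_of_quadratic {M : Type*} [Field M] {x : M} {a n : ℤ}
    (hx : x ^ 2 - a * x + n = 0) : IsIntegral ℤ x := by
  refine ⟨X ^ 2 - C a * X + C n, by monicity!, ?_⟩
  simp only [eval₂_add, eval₂_sub, eval₂_mul, eval₂_X_pow, eval₂_X, eval₂_C]
  simpa using hx

/-- **The integral data of Hecke's criterion at `3`.**  In a number field `M` containing `λ` (`λ² = −3`)
and `δ` (`δ² = −d`), for `−d` fundamental with `3d = d₀c₀²`, `a² − d₀b² = 4n` (`n = ±1`) and the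
congruences of `UnitCubeAtThree` for `(a + b√d₀)⁸ = X + Y√d₀` (`√d₀ = δλ/c₀`): the unit
`ε = a/2 + (b/2c₀)δλ = (a + b√d₀)/2` of `𝓞_M` satisfies `ε⁸ = 1 + λ³w` with `w ∈ 𝓞_M`.
[cite: Hecke1981, §39 Thm. 119] -/
theorem exists_ringOfIntegers_unit_data {M : Type*} [Field M] [NumberField M] {lamM δM : M}
    (hlam : lamM ^ 2 = -3) {d : ℕ} (hδ : δM ^ 2 = -(d : M)) {a b c₀ : ℕ} {n : ℤ}
    (hn : n = 1 ∨ n = -1) (hab : (a:ℤ) ^ 2 - (mirrorRadicand d : ℤ) * (b:ℤ) ^ 2 = 4 * n)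
    (hc₀0 : c₀ ≠ 0) (hc₀ : 3 * d = mirrorRadicand d * c₀ ^ 2)
    (hX : (unitPow8 d a b).re % 9 = 4) (hY9 : 3 ∣ d → (9:ℤ) ∣ (unitPow8 d a b).im)
    (hY3 : ¬ 3 ∣ d → (3:ℤ) ∣ (unitPow8 d a b).im) :
    ∃ lamO uO wO : 𝓞 M, lamO ^ 2 = -3 ∧ uO = 1 + lamO ^ 3 * wO ∧ IsUnit uO ∧
      (lamO : M) = lamM ∧ (uO : M) = ((a : M) / 2 + (b : M) / (2 * c₀) * δM * lamM) ^ 8 := by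
  set d₀ := mirrorRadicand d with hd₀
  have hc₀M : (c₀ : M) ≠ 0 := Nat.cast_ne_zero.mpr hc₀0
  have h3d : (3 * d : M) = d₀ * (c₀ : M) ^ 2 := by exact_mod_cast hc₀
  have habM : (a : M) ^ 2 - d₀ * (b : M) ^ 2 = 4 * n := by exact_mod_cast hab
  -- `s = δλ/c₀`, `s² = d₀`; `ε = (a + bs)/2`, `ε̄ = (a − bs)/2`
  set sM : M := δM * lamM / c₀ with hsM
  have hs2 : sM ^ 2 = d₀ := by
    rw [hsM, div_pow, mul_pow, hδ, hlam, div_eq_iff (pow_ne_zero 2 hc₀M)]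
    linear_combination h3d
  set εM : M := (a : M) / 2 + (b : M) / (2 * c₀) * δM * lamM with hεM
  set εbM : M := (a : M) / 2 - (b : M) / (2 * c₀) * δM * lamM with hεbM
  have h2ε : 2 * εM = a + b * sM := by rw [hεM, hsM]; field_simp
  have h2εb : 2 * εbM = a - b * sM := by rw [hεbM, hsM]; field_simp
  have hεεb : εM * εbM = n := by
    linear_combination (1 / 4 : M) * ((2 * εbM) * h2ε + (a + b * sM) * h2εb - (b : M) ^ 2 * hs2 + habM)
  -- integrality
  have hεint : IsIntegral ℤ εM := isIntegral_of_quadratic (a := a) (n := n) (by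
    push_cast
    linear_combination (1 / 4 : M) * ((2 * εM - a + b * sM) * h2ε + (b : M) ^ 2 * hs2 - habM))
  have hεbint : IsIntegral ℤ εbM := isIntegral_of_quadratic (a := a) (n := n) (by
    push_cast
    linear_combination (1 / 4 : M) * ((2 * εbM - a - b * sM) * h2εb + (b : M) ^ 2 * hs2 - habM))
  have hlamint : IsIntegral ℤ lamM :=
    Quadratic.isIntegral_of_sq_eq_intCast (n := -3) (by rw [hlam]; norm_num)
  have hsint : IsIntegral ℤ sM :=
    Quadratic.isIntegral_of_sq_eq_intCast (n := d₀) (by rw [hs2]; norm_num)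
  set lamO : 𝓞 M := ⟨lamM, hlamint⟩
  set epsO : 𝓞 M := ⟨εM, hεint⟩
  set epsbO : 𝓞 M := ⟨εbM, hεbint⟩
  set sO : 𝓞 M := ⟨sM, hsint⟩
  have hlamO : lamO ^ 2 = -3 := RingOfIntegers.ext (by
    simp only [map_pow, map_neg, map_ofNat]; exact hlam)
  -- `ε` is a unit: `ε · (n ε̄) = n² = 1`
  have hunit : IsUnit epsO := by
    refine IsUnit.of_mul_eq_one ((n : 𝓞 M) * epsbO) (RingOfIntegers.ext ?_)
    have h1 : (algebraMap (𝓞 M) M) epsO = εM := rfl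
    have h2 : (algebraMap (𝓞 M) M) epsbO = εbM := rfl
    simp only [map_mul, map_one, map_intCast]
    rw [h1, h2, mul_left_comm, hεεb]
    rcases hn with rfl | rfl <;> norm_num
  -- `256 ε⁸ = X + Y s` from `(a + b√d₀)⁸ = X + Y√d₀` in `ℤ[√d₀]`
  have hss : sM * sM = ((d₀ : ℤ) : M) := by rw [← sq, hs2, Int.cast_natCast]
  have h256 : (256 : M) * εM ^ 8 = (unitPow8 d a b).re + (unitPow8 d a b).im * sM := by
    have h1 : Zsqrtd.lift ⟨sM, hss⟩ (⟨a, b⟩ : ℤ√(d₀ : ℤ)) = a + b * sM := by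
      rw [Zsqrtd.lift_apply_apply]; push_cast; rfl
    have h2 := Zsqrtd.lift_apply_apply ⟨sM, hss⟩ ((⟨a, b⟩ : ℤ√(d₀ : ℤ)) ^ 8)
    rw [map_pow, h1, ← h2ε] at h2
    show (256 : M) * εM ^ 8 =
      ((((⟨a, b⟩ : ℤ√(d₀ : ℤ)) ^ 8).re : ℤ) : M) + ((((⟨a, b⟩ : ℤ√(d₀ : ℤ)) ^ 8).im : ℤ) : M) * sM
    linear_combination h2
  have hX' : (unitPow8 d a b).re = 9 * ((unitPow8 d a b).re / 9) + 4 := by omega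
  refine ⟨lamO, epsO ^ 8, ?_⟩
  by_cases h3 : 3 ∣ d
  · -- `9 ∣ Y`
    obtain ⟨Y₁, hY₁⟩ := hY9 h3
    have h256O : (256 : 𝓞 M) * epsO ^ 8 =
        ((unitPow8 d a b).re : 𝓞 M) + ((unitPow8 d a b).im : 𝓞 M) * sO := RingOfIntegers.ext (by
      simp only [map_mul, map_add, map_pow, map_ofNat, map_intCast]; exact h256)
    refine ⟨lamO * (57 * ((epsO ^ 8) - 1) -
        2 * ((((unitPow8 d a b).re / 9 : ℤ) : 𝓞 M) + (Y₁ : 𝓞 M) * sO - 28)), hlamO,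
      pow_eight_eq_of_nine_dvd hlamO h256O hX' hY₁, hunit.pow 8, rfl, ?_⟩
    simp only [map_pow]
    rfl
  · -- `3 ∣ Y`, `3 ∣ d₀`, `μ = δ/c₀` integral with `s = λ μ`
    obtain ⟨Y₁, hY₁⟩ := hY3 h3
    obtain ⟨d₁, hd₁⟩ := three_dvd_mirrorRadicand h3
    set μM : M := δM / c₀ with hμM
    have hμ2 : μM ^ 2 = ((-(d₁ : ℤ) : ℤ) : M) := by
      have hd' : (d : M) = d₁ * (c₀ : M) ^ 2 := by
        have : 3 * d = 3 * (d₁ * c₀ ^ 2) := by rw [hc₀, hd₀.trans hd₁]; ring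
        exact_mod_cast Nat.eq_of_mul_eq_mul_left (by norm_num) this
      rw [hμM, div_pow, hδ, hd', div_eq_iff (pow_ne_zero 2 hc₀M)]
      push_cast
      ring
    have hμint : IsIntegral ℤ μM := Quadratic.isIntegral_of_sq_eq_intCast hμ2
    set muO : 𝓞 M := ⟨μM, hμint⟩
    have hsμ : sM = lamM * μM := by rw [hsM, hμM]; ring
    rw [hsμ] at h256
    have h256O : (256 : 𝓞 M) * epsO ^ 8 =
        ((unitPow8 d a b).re : 𝓞 M) + ((unitPow8 d a b).im : 𝓞 M) * (lamO * muO) :=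
      RingOfIntegers.ext (by
        simp only [map_mul, map_add, map_pow, map_ofNat, map_intCast]
        exact h256)
    refine ⟨57 * lamO * (epsO ^ 8 - 1) - 2 * lamO * ((((unitPow8 d a b).re / 9 : ℤ) : 𝓞 M) - 28) +
        2 * (Y₁ : 𝓞 M) * muO, hlamO, pow_eight_eq_of_three_dvd hlamO h256O hX' hY₁, hunit.pow 8,
      rfl, ?_⟩
    simp only [map_pow]
    rfl

end UnitData

/-! ### Direction (i): `UnitCubeAtThree d → 3 ∣ h(−d)` -/

section Assembly

open NumberFields IntermediateField IsDedekindDomain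

/-- `√−3 ∉ K = ℚ(√−d)` for fundamental `−d ≠ −3`. [folklore] -/
theorem algebraMap_ne_lam {K L : Type*} [Field K] [CharZero K] [Field L] [Algebra K L]
    (h2 : finrank ℚ K = 2) {δ : K} (hδ : δ ∉ Set.range (algebraMap ℚ K)) {d : ℕ}
    (hδ2 : δ ^ 2 = -(d : K))
    (hd : ((-(d:ℤ)) % 4 = 1 ∧ Squarefree (-(d:ℤ)) ∧ (-(d:ℤ)) ≠ 1) ∨
      (4 ∣ (-(d:ℤ)) ∧ ((-(d:ℤ)) / 4 % 4 = 2 ∨ (-(d:ℤ)) / 4 % 4 = 3) ∧ Squarefree ((-(d:ℤ)) / 4)))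
    (h3 : d ≠ 3) {lam : L} (hlam : lam ^ 2 = -3) (x : K) : algebraMap K L x ≠ lam := by
  intro hx
  have hx2 : x ^ 2 = -3 :=
    (algebraMap K L).injective (by rw [map_pow, hx, hlam, map_neg, map_ofNat])
  obtain ⟨r, t, rfl⟩ := Quadratic.exists_eq_add_mul h2 hδ x
  have key : algebraMap ℚ K (r ^ 2 - d * t ^ 2) + algebraMap ℚ K (2 * r * t) * δ =
      algebraMap ℚ K (-3) + algebraMap ℚ K 0 * δ := by
    rw [map_zero, zero_mul, add_zero, map_neg, map_ofNat, ← hx2]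
    simp only [map_sub, map_mul, map_pow, map_natCast, map_ofNat]
    linear_combination (-(algebraMap ℚ K t) ^ 2) * hδ2
  obtain ⟨h1, h2'⟩ := Quadratic.ext_add_mul hδ key
  rcases mul_eq_zero.mp (show r * t = 0 by linear_combination h2' / 2) with hr | ht
  · subst hr
    exact not_exists_rat_sq hd h3 ⟨t, by linear_combination -h1⟩
  · subst ht
    nlinarith [h1, sq_nonneg r]

/-- **Direction (i) of the Scholz–Hecke criterion, for the quadratic field `K` itself**: if the
fundamental unit of the mirror field is a cube at `3` (`UnitCubeAtThree d`), then `3 ∣ h_K` for the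
quadratic field `K` of discriminant `−d`.  Proof (Washington, proof of Thm 10.10, with Hecke Satz 119
at the prime `3`): `N = K(√−3, ∛ε)` is abelian of degree `6` over `K` (`KummerSexticAbelian`), its cubic
subfield `E/K` is cyclic; `N/M`, `M = K(√−3)`, is unramified because `ε` is a unit with `ε⁸ ≡ 1
(mod (√−3)³)` (`KummerCubeRootUnramified`), hence `E/K` is unramified (`UnramifiedDescentPrimeDegree`),
and an unramified `C₃`-extension forces `3 ∣ h_K` by class field theory
(`UnramifiedCyclicDegreeDvdClassNumber`). [cite: Washington1997, Thm 10.10 (proof)]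
[cite: Hecke1981, §39 Thms 118–119] -/
theorem three_dvd_classNumber_of_unitCubeAtThree {K : Type} [Field K] [NumberField K]
    (h2 : finrank ℚ K = 2) {δ : K} (hδ : δ ∉ Set.range (algebraMap ℚ K)) {d : ℕ}
    (hδ2 : δ ^ 2 = -(d : K))
    (hd : ((-(d:ℤ)) % 4 = 1 ∧ Squarefree (-(d:ℤ)) ∧ (-(d:ℤ)) ≠ 1) ∨
      (4 ∣ (-(d:ℤ)) ∧ ((-(d:ℤ)) / 4 % 4 = 2 ∨ (-(d:ℤ)) / 4 % 4 = 3) ∧ Squarefree ((-(d:ℤ)) / 4)))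
    (h3 : d ≠ 3) (hu : UnitCubeAtThree d) : 3 ∣ classNumber K := by
  -- arithmetic data
  obtain ⟨a, b, ⟨hb, hab', hmin⟩, hX, hY9, hY3⟩ := hu
  have hsq := squarefree_mirrorRadicand hd
  have h1 := mirrorRadicand_ne_one hd h3
  obtain ⟨c₀, hc₀pos, hc₀⟩ := exists_three_mul_eq_mirrorRadicand_mul_sq d
  have hc₀0 : c₀ ≠ 0 := hc₀pos.ne'
  obtain ⟨n, hn, hab⟩ : ∃ n : ℤ, (n = 1 ∨ n = -1) ∧
      (a:ℤ) ^ 2 - (mirrorRadicand d : ℤ) * (b:ℤ) ^ 2 = 4 * n := by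
    rcases hab' with h | h
    · exact ⟨1, Or.inl rfl, by rw [h]; norm_num⟩
    · exact ⟨-1, Or.inr rfl, by rw [h]; norm_num⟩
  -- `λ = √−3` and `y = ∛ε` in an algebraic closure `Ω` of `K`
  obtain ⟨lam, hlam⟩ : ∃ lam : AlgebraicClosure K, lam ^ 2 = -3 :=
    IsAlgClosed.exists_pow_nat_eq _ two_pos
  have hlamK : ∀ x : K, algebraMap K (AlgebraicClosure K) x ≠ lam :=
    algebraMap_ne_lam h2 hδ hδ2 hd h3 hlam
  set p : K := (a : K) / 2 with hp
  set q : K := (b : K) / (2 * c₀) * δ with hq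
  have hc₀K : (c₀ : K) ≠ 0 := Nat.cast_ne_zero.mpr hc₀0
  have hnorm : p ^ 2 + 3 * q ^ 2 = (n : K) ^ 3 := by
    have hn3 : ((n : K)) ^ 3 = n := by rcases hn with rfl | rfl <;> norm_num
    have h3d : (3 * d : K) = mirrorRadicand d * (c₀ : K) ^ 2 := by exact_mod_cast hc₀
    have habK : (a : K) ^ 2 - mirrorRadicand d * (b : K) ^ 2 = 4 * n := by exact_mod_cast hab
    rw [hn3, hp, hq]
    field_simp
    linear_combination (c₀ : K) ^ 2 * habK + 3 * (b : K) ^ 2 * hδ2 * 1 - (b : K) ^ 2 * h3d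
  obtain ⟨y, hy⟩ : ∃ y : AlgebraicClosure K,
      y ^ 3 = algebraMap K _ p + algebraMap K _ q * lam := IsAlgClosed.exists_pow_nat_eq _ three_pos
  have hcube : ∀ c ∈ K⟮lam⟯, c ^ 3 ≠ algebraMap K _ p + algebraMap K _ q * lam := fun c hc =>
    pow_three_ne_unit h2 hδ hδ2 hlam hlamK hsq h1 hb hn hab hmin hc₀ hc₀0 hc
  -- the Kummer tower `K ⊆ M = K(λ') ⊆ N = K(λ, y)` and the cubic subfield `E`
  haveI := KummerSextic.isGalois_adjoin_pair hlam hlamK hy hnorm hcube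
  haveI := KummerSextic.finiteDimensional_adjoin_pair (F := K) hlam hy hnorm
  haveI : NumberField K⟮lam, y⟯ := NumberField.of_module_finite K _
  obtain ⟨E, hEgal, hE3⟩ :=
    KummerSextic.exists_cubic_galois_intermediateField hlam hlamK hy hnorm hcube
  haveI := hEgal
  have hd0 : 0 < d := pos hd
  refine dvd_classNumber_of_isUnramifiedIn_of_prime_card K E Nat.prime_three
    (by rw [IsGalois.card_aut_eq_finrank, hE3])
    (isEmpty_ringHom_real_of_sq_eq (q := -(d : ℚ)) (δ := δ)
      (by simpa using hd0) (by push_cast; exact hδ2)) fun v => ?_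
  haveI := v.isMaximal
  -- internal generators
  let lam' : K⟮lam, y⟯ := ⟨lam, KummerSextic.lam_mem⟩
  let y' : K⟮lam, y⟯ := ⟨y, KummerSextic.y_mem⟩
  have hyN : y' ^ 3 = algebraMap K K⟮lam, y⟯ p + algebraMap K _ q * lam' :=
    KummerSextic.y'_pow_three hy rfl rfl
  have hy0 : y' ≠ 0 := fun h => KummerSextic.y_ne_zero hy hcube (congrArg Subtype.val h)
  -- the field `M = K(λ')` and its elements `λ`, `δ`
  have hlamM : (AdjoinSimple.gen K lam') ^ 2 = -3 := by
    apply (algebraMap K⟮lam'⟯ K⟮lam, y⟯).injective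
    rw [map_pow, AdjoinSimple.algebraMap_gen, map_neg, map_ofNat]
    exact KummerSextic.lam'_sq hlam rfl
  have hδM : (algebraMap K K⟮lam'⟯ δ) ^ 2 = -(d : K⟮lam'⟯) := by
    rw [← map_pow, hδ2, map_neg, map_natCast]
  obtain ⟨lamO, uO, wO, hlamO, huw, hunit, hlamOM, huO⟩ :=
    exists_ringOfIntegers_unit_data (M := K⟮lam'⟯) hlamM hδM hn hab hc₀0 hc₀ hX hY9 hY3
  -- `y'^8` is a cube root of `u = ε⁸` generating `N` over `M`
  have hεN : algebraMap K⟮lam'⟯ K⟮lam, y⟯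
      ((a : K⟮lam'⟯) / 2 + (b : K⟮lam'⟯) / (2 * c₀) * algebraMap K K⟮lam'⟯ δ * AdjoinSimple.gen K lam') =
      y' ^ 3 := by
    rw [hyN, hp, hq]
    simp only [map_add, map_mul, map_div₀, map_natCast, map_ofNat, AdjoinSimple.algebraMap_gen]
    rw [← IsScalarTower.algebraMap_apply]
  have hy8 : (y' ^ 8) ^ 3 = algebraMap (𝓞 K⟮lam'⟯) K⟮lam, y⟯ uO := by
    rw [IsScalarTower.algebraMap_apply (𝓞 K⟮lam'⟯) K⟮lam'⟯ K⟮lam, y⟯, ← RingOfIntegers.coe_eq_algebraMap,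
      huO, map_pow, hεN]
    ring
  have hgen : IntermediateField.adjoin K⟮lam'⟯ {y' ^ 8} = ⊤ := by
    have hy3mem : y' ^ 3 ∈ IntermediateField.adjoin K⟮lam'⟯ {y' ^ 8} := by
      rw [← hεN]; exact IntermediateField.algebraMap_mem _ _
    have h8mem : y' ^ 8 ∈ IntermediateField.adjoin K⟮lam'⟯ {y' ^ 8} :=
      IntermediateField.subset_adjoin _ _ (Set.mem_singleton _)
    have key : (y' ^ 8) ^ 2 * ((y' ^ 3) ^ 5)⁻¹ ∈ IntermediateField.adjoin K⟮lam'⟯ {y' ^ 8} :=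
      mul_mem (pow_mem h8mem 2) (inv_mem (pow_mem hy3mem 5))
    have hyeq : (y' ^ 8) ^ 2 * ((y' ^ 3) ^ 5)⁻¹ = y' := by
      rw [← pow_mul, ← pow_mul, mul_inv_eq_iff_eq_mul₀ (pow_ne_zero _ hy0)]
      ring
    rw [hyeq] at key
    rw [eq_top_iff, ← KummerSextic.adjoin_adjoin_lam_y_eq_top (F := K) (lam := lam) (y := y),
      adjoin_le_iff, Set.singleton_subset_iff]
    exact key
  have h𝔞 : Ideal.span {uO} = (⊤ : Ideal (𝓞 K⟮lam'⟯)) ^ 3 := by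
    rw [Ideal.span_singleton_eq_top.mpr hunit, Ideal.top_pow]
  -- descent: `N/M` unramified everywhere (Hecke) ⇒ `E/K` unramified everywhere
  exact isUnramifiedIn_of_prime_finrank_of_isUnramifiedAt_tower (F := K) (E := E) (M := K⟮lam'⟯)
    (N := K⟮lam, y⟯) Nat.prime_three hE3
    (by rw [KummerSextic.finrank_adjoin_lam_internal hlam hlamK]; norm_num)
    (fun 𝔔 _ => isUnramifiedAt_of_cube_root_one_mod_lambda_cubed hlamO huw hunit.ne_zero h𝔞 hy8
      hgen 𝔔) v.asIdeal

/-- **Direction (i) of `ScholzHecke_unitCubeCriterion`**: for `−d` a negative fundamental discriminant,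
`d ≠ 3`, `UnitCubeAtThree d → 3 ∣ h(−d)` (`h(−d) = BinaryQuadraticForm.classNumber (−d) = h_K`,
Cox Thm 7.7). [cite: Washington1997, Thm 10.10 (proof)] -/
theorem cube_imp_three_dvd {d : ℕ}
    (hd : ((-(d:ℤ)) % 4 = 1 ∧ Squarefree (-(d:ℤ)) ∧ (-(d:ℤ)) ≠ 1) ∨
      (4 ∣ (-(d:ℤ)) ∧ ((-(d:ℤ)) / 4 % 4 = 2 ∨ (-(d:ℤ)) / 4 % 4 = 3) ∧ Squarefree ((-(d:ℤ)) / 4)))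
    (h3 : d ≠ 3) (hu : UnitCubeAtThree d) : 3 ∣ BinaryQuadraticForm.classNumber (-(d:ℤ)) := by
  obtain ⟨K, _, _, h2, hdisc⟩ := Quadratic.exists_numberField_discr_eq hd
  have hd0 : (-(d:ℤ)) < 0 := by have := pos hd; omega
  rw [← hdisc, Quadratic.card_reducedForms_eq_classNumber h2 (hdisc ▸ hd0)]
  obtain ⟨δ, hδ, hδ2⟩ := Quadratic.exists_not_mem_range_sq_eq_discr h2
  rw [hdisc] at hδ2
  have hδ2' : δ ^ 2 = -(d : K) := by rw [hδ2, eq_ratCast]; push_cast; ring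
  exact three_dvd_classNumber_of_unitCubeAtThree h2 hδ hδ2' hd h3 hu

end Assembly

end ScholzHecke

end Literature.NumberTheory.QuadraticFields

end
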